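import Summits.Ventures.GridStability.Models.RelativeSwingLFFOffDiag

/-!
# GridStability/Models/RelativeSwingLFFLines — the LFF bridge on UNORDERED lines (one line per machine pair, full weight)

Cell `gridfusion` (LFF lane; lit-6 01:54:18Z: «κ = the UNORDERED lines with w_k > 0 only … w = E_iE_jB_ij
— NOT halved … (preferred, smaller)»), seat gridfusion-model-1; continuation of `RelativeSwingLFF.lean`
(p484338) / `RelativeSwingLFFOffDiag.lean` (p485188). THREE COLUMNS: MODELLED only (MV-2L + MV-λ).

* `LffLine n = {k : Fin (n+1) × Fin (n+1) // k.1 < k.2}` — one line per unordered machine pair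
  (`n(n+1)/2` lines: 3 for WSCC9, 45 for NE39), `lffEu` (row `θ_i − θ_j`, `i < j`, `θ_0 ≡ 0`),
  `lffWu = C_ij = E_iE_jB_ij` (FULL weight), `lffδsu`, `lffSystemU`;
* `pairSum_eq_two_mul_lineSum` — bookkeeping: a swap-symmetric function vanishing on the diagonal sums
  over all ordered pairs to twice its sum over the lines;
* `lffSystemU_field_eq` — the vector field of `lffSystemU` EQUALS that of `lffSystem` (all states);
* `hasDerivWithinAt_lffState_lines` — THE BRIDGE for this presentation;
* `lffEu_injective_aux`, `lffSystemU_obs`, `lffSystemU_C_mul_B`, `lffWu_pos` (`0 < C_ij ⇒ 0 < w`).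
-/

noncomputable section

open Real Finset Matrix
open Literature.MathematicalPhysics.PowerSystems

namespace Summit.Ventures.GridStability.Models

namespace RecastData

variable {n : ℕ} (d : RecastData n)

/-- Unordered machine pairs, represented as ordered pairs `(i, j)` with `i < j`. -/
abbrev LffLine (n : ℕ) : Type := {k : Fin (n + 1) × Fin (n + 1) // k.1 < k.2}

/-- Line matrix on unordered lines (row `θ_i − θ_j`, `i < j`). -/
def lffEu (n : ℕ) : Matrix (LffLine n) (Fin n) ℝ := fun k m => lffE n k.1 m

/-- FULL weights `w_{ij} = C_ij = E_iE_jB_ij`. -/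
def lffWu : LffLine n → ℝ := fun k => (d.Cc k.1.1 k.1.2 : ℝ)

/-- Equilibrium line angles on unordered lines. -/
def lffδsu (δs : Fin (n + 1) → ℝ) : LffLine n → ℝ := fun k => lffδs δs k.1

/-- lit-6's `relativeSwing` on the unordered line set. MODELLED: MV-2L + MV-λ. -/
def lffSystemU (lam : ℚ) (δs : Fin (n + 1) → ℝ) :
    LyapunovFunctionFamily.System (Fin n ⊕ Fin n) (LffLine n) :=
  LyapunovFunctionFamily.System.relativeSwing (fun m => (d.M m.succ : ℝ)) (d.M 0 : ℝ) (lam : ℝ)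
    (lffEu n) d.lffWu (lffδsu δs)

/-- Bookkeeping: a function on ordered pairs that is symmetric under swapping and vanishes on the
diagonal sums, over ALL ordered pairs, to twice its sum over the lines `i < j`. -/
theorem pairSum_eq_two_mul_lineSum (f : Fin (n + 1) × Fin (n + 1) → ℝ)
    (hswap : ∀ i j, f (j, i) = f (i, j)) (hdiag : ∀ i, f (i, i) = 0) :
    ∑ k, f k = 2 * ∑ k : LffLine n, f k.1 := by
  have hsplit : ∀ k : Fin (n + 1) × Fin (n + 1), f k =
      (if k.1 < k.2 then f k else 0) + (if k.2 < k.1 then f k else 0) := by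
    rintro ⟨i, j⟩
    rcases lt_trichotomy i j with h | h | h
    · simp [h, not_lt.2 h.le]
    · subst h; simp [hdiag]
    · simp [h, not_lt.2 h.le]
  rw [Finset.sum_congr rfl fun k _ => hsplit k, Finset.sum_add_distrib]
  have hgt : ∑ k : Fin (n + 1) × Fin (n + 1), (if k.2 < k.1 then f k else 0) =
      ∑ k : Fin (n + 1) × Fin (n + 1), (if k.1 < k.2 then f k else 0) := by
    rw [← Equiv.sum_comp (Equiv.prodComm (Fin (n + 1)) (Fin (n + 1)))]
    refine Finset.sum_congr rfl ?_
    rintro ⟨i, j⟩ _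
    simp [hswap]
  rw [hgt, ← two_mul, ← Finset.sum_subtype (univ.filter fun k : Fin (n + 1) × Fin (n + 1) => k.1 < k.2)
    (fun k => by simp) (fun k => f k), Finset.sum_filter]

/-- `(Eᵤ v)_k = (E v)_{k.1}`. -/
theorem lffEu_mulVec (v : Fin n → ℝ) (k : LffLine n) : (lffEu n *ᵥ v) k = (lffE n *ᵥ v) k.1 := rfl

/-- The nonlinearity of the unordered presentation is the restriction of the full one. -/
theorem lffSystemU_nonlin (lam : ℚ) (δs : Fin (n + 1) → ℝ) (y : Fin n ⊕ Fin n → ℝ) (k : LffLine n) :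
    (d.lffSystemU lam δs).nonlin y k = (d.lffSystem lam δs).nonlin y k.1 := by
  simp only [LyapunovFunctionFamily.System.nonlin, lffSystemU, lffSystem,
    LyapunovFunctionFamily.System.relativeSwing, LyapunovFunctionFamily.System.secondOrder_C_mulVec]
  rfl

/-- Swapping a pair flips the line row of `E`. -/
theorem lffE_swap (i j : Fin (n + 1)) (m : Fin n) : lffE n (j, i) m = -lffE n (i, j) m := by
  simp only [lffE]; ring

/-- Swapping a pair flips the full nonlinearity at any state. -/
theorem lffSystem_nonlin_swap (lam : ℚ) (δs : Fin (n + 1) → ℝ) (y : Fin n ⊕ Fin n → ℝ)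
    (i j : Fin (n + 1)) :
    (d.lffSystem lam δs).nonlin y (j, i) = -(d.lffSystem lam δs).nonlin y (i, j) := by
  simp only [LyapunovFunctionFamily.System.nonlin]
  have hC : ∀ k, ((d.lffSystem lam δs).C *ᵥ y) k = (lffE n *ᵥ (y ∘ Sum.inl)) k := fun k => by
    rw [lffSystem, LyapunovFunctionFamily.System.relativeSwing,
      LyapunovFunctionFamily.System.secondOrder_C_mulVec]
  have hδ : ∀ k, (d.lffSystem lam δs).δs k = δs k.1 - δs k.2 := fun k => rfl
  rw [hC, hC, hδ, hδ, lffE_mulVec, lffE_mulVec]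
  simp only
  set v : Fin (n + 1) → ℝ := fun l => Fin.cases (0 : ℝ) (y ∘ Sum.inl) l with hv
  have e1 : δs j - δs i + (v j - v i) = -(δs i - δs j + (v i - v j)) := by ring
  have e2 : δs j - δs i = -(δs i - δs j) := by ring
  rw [e1, e2, Real.sin_neg, Real.sin_neg]
  ring

/-- `Eᵤᵀ (C·Fᵤ) = Eᵀ ((C/2)·F)`: the unordered full-weight presentation and the all-pairs half-weight
presentation have the same coupling term. -/
theorem lffEu_transpose_mulVec (lam : ℚ) (hB : ∀ i j, d.B i j = d.B j i) (δs : Fin (n + 1) → ℝ)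
    (y : Fin n ⊕ Fin n → ℝ) (m : Fin n) :
    ((lffEu n)ᵀ *ᵥ fun k : LffLine n => d.lffWu k * (d.lffSystemU lam δs).nonlin y k) m =
      ((lffE n)ᵀ *ᵥ fun k => d.lffW k * (d.lffSystem lam δs).nonlin y k) m := by
  simp only [mulVec, dotProduct, transpose_apply, lffEu, lffWu, lffW, lffSystemU_nonlin]
  symm
  have h := pairSum_eq_two_mul_lineSum
    (fun k => lffE n k m * ((d.Cc k.1 k.2 : ℝ) / 2 * (d.lffSystem lam δs).nonlin y k)) ?_ ?_
  · rw [h, Finset.mul_sum]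
    refine Finset.sum_congr rfl fun k _ => ?_
    ring
  · intro i j
    have hC : d.Cc j i = d.Cc i j := by simp only [Cc, hB j i]; ring
    simp only
    rw [lffE_swap, d.lffSystem_nonlin_swap, hC]
    ring
  · intro i
    simp [lffE_diag]

/-- **The unordered presentation has the same vector field** (at every state). -/
theorem lffSystemU_field_eq (lam : ℚ) (hB : ∀ i j, d.B i j = d.B j i) (δs : Fin (n + 1) → ℝ)
    (y : Fin n ⊕ Fin n → ℝ) :
    (d.lffSystemU lam δs).field y = (d.lffSystem lam δs).field y := by
  funext idx
  rcases idx with m | m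
  · rw [lffSystemU, lffSystem, LyapunovFunctionFamily.System.relativeSwing,
      LyapunovFunctionFamily.System.relativeSwing, secondOrder_field_inl, secondOrder_field_inl]
  · rw [lffSystemU, LyapunovFunctionFamily.System.relativeSwing, secondOrder_field_inr,
      ← LyapunovFunctionFamily.System.relativeSwing]
    conv_rhs => rw [lffSystem, LyapunovFunctionFamily.System.relativeSwing, secondOrder_field_inr,
      ← LyapunovFunctionFamily.System.relativeSwing]
    congr 1
    rw [← mulVec_mulVec, ← mulVec_mulVec, ← mulVec_mulVec, ← mulVec_mulVec]
    congr 1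
    funext m'
    have hW : Matrix.diagonal d.lffWu *ᵥ (d.lffSystemU lam δs).nonlin y =
        fun k : LffLine n => d.lffWu k * (d.lffSystemU lam δs).nonlin y k := by
      funext k; simp [mulVec_diagonal]
    have hW' : Matrix.diagonal d.lffW *ᵥ (d.lffSystem lam δs).nonlin y =
        fun k' => d.lffW k' * (d.lffSystem lam δs).nonlin y k' := by
      funext k; simp [mulVec_diagonal]
    simp only [lffSystemU, lffSystem] at hW hW'
    rw [hW, hW']
    exact d.lffEu_transpose_mulVec lam hB δs y m'

/-- **THE BRIDGE on unordered lines.** -/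
theorem hasDerivWithinAt_lffState_lines (lam : ℚ) (a : ℝ) (hG : ∀ i j, i ≠ j → d.G i j = 0)
    (hB : ∀ i j, d.B i j = d.B j i) {δs : Fin (n + 1) → ℝ} (h : d.EqData δs)
    (hM : ∀ i, d.M i ≠ 0) {c : ℝ → ClassicalSwing.State (n + 1)} {s : Set ℝ}
    (hc : (d.toModelRel lam a).IsSolutionOn c s) {t : ℝ} (ht : t ∈ s) :
    HasDerivWithinAt (fun τ => lffState δs (c τ))
      ((d.lffSystemU lam δs).field (lffState δs (c t))) s t := by
  rw [d.lffSystemU_field_eq lam hB]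
  exact d.hasDerivWithinAt_lffState lam a hG hB h hM hc ht

/-- `ker Eᵤ = 0`: the rows `(0, m+1)` read `−v_m`. -/
theorem lffEu_injective_aux (v : Fin n → ℝ) (hv : lffEu n *ᵥ v = 0) : v = 0 := by
  funext m
  have hk : ((0 : Fin (n + 1)), m.succ).1 < ((0 : Fin (n + 1)), m.succ).2 := Fin.succ_pos m
  have h := congrFun hv ⟨((0 : Fin (n + 1)), m.succ), hk⟩
  rw [lffEu_mulVec] at h
  simp only [Pi.zero_apply] at h
  rw [lffE_mulVec] at h
  simpa using h

/-- `CB = 0` (unordered presentation). -/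
theorem lffSystemU_C_mul_B (lam : ℚ) (δs : Fin (n + 1) → ℝ) :
    (d.lffSystemU lam δs).C * (d.lffSystemU lam δs).B = 0 :=
  LyapunovFunctionFamily.System.relativeSwing_C_mul_B _ _ _ _ _ _

/-- Observability (unordered presentation). -/
theorem lffSystemU_obs (lam : ℚ) (δs : Fin (n + 1) → ℝ) (x : Fin n ⊕ Fin n → ℝ)
    (h1 : (d.lffSystemU lam δs).C *ᵥ x = 0)
    (h2 : (d.lffSystemU lam δs).C *ᵥ ((d.lffSystemU lam δs).A *ᵥ x) = 0) : x = 0 :=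
  LyapunovFunctionFamily.System.relativeSwing_obs _ _ _ _ _ _ (fun v hv => lffEu_injective_aux v hv) x h1 h2

/-- Positive weights: `0 < C_ij` for `i ≠ j` gives `0 < w` on every line. -/
theorem lffWu_pos (hC : ∀ i j : Fin (n + 1), i ≠ j → 0 < d.Cc i j) (k : LffLine n) : 0 < d.lffWu k := by
  have h := hC k.1.1 k.1.2 (ne_of_lt k.2)
  simp only [lffWu]
  exact_mod_cast h

/-- Equilibrium line angles of the unordered presentation. -/
theorem lffSystemU_δs (lam : ℚ) (δs : Fin (n + 1) → ℝ) (k : LffLine n) :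
    (d.lffSystemU lam δs).δs k = δs k.1.1 - δs k.1.2 := rfl

end RecastData

end Summit.Ventures.GridStability.Models

end
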